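/-
Copyright (c) 2026 the pub-hodgecm-mathlib formalisation cell (harness21).  Prover seat hodgecm-mathlib-LH4-p07 (g8), req620 Track A «(D-RAM) FOUR-FRAME» squad
(STAGE-1b pre-scoping, heir LEAD F0P3a-plan (g20∕g21) T19-24 clause; dealer LH4-plan (g12∕g13) WORD #36 «p07 (g8): row-(2) lead»), 2026-09-04.
-/
import Summits.HodgeConjecture.HodgeConjecture.Theorems.F0P3cDyRamBlockGlueTwoTokenCount           -- ★ p859113 (this seat): (C1-P^{X,Y}) part 1, O-GLUE COUNT with two block tokens; brings ★ p858981 ∕ p858946 ∕ p858894 ∕ p858844, ★ (C1) p857559, ★ DEFS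
import Summits.HodgeConjecture.HodgeConjecture.Theorems.F0P3cDyRamBlockCensusOrderFormTwoTokensAxis  -- ★ (this seat): part 2a, (W4₃) + (C₂^{X,Y}) axis with two tokens in M-letters
import HarnessLib

/-!
# Crux `H413`, line LH4 «(D-RAM) FOUR-FRAME» — STAGE-1b, row (2): organ (C1-P^{X,Y}) part 2b «THE BLOCK CENSUS WITH TWO GENERIC BLOCK TOKENS, IN M-LETTERS»
# `#{M ∣ SD, Γ·M = M, X·M ⊆ cM, Y·M ⊆ c′M} = Σ_{j ≤ J} [lam, (jE c)⁻¹ξ, (jE c′)⁻¹η ∈ 𝒪_j]·#levelSet(j,0) + Σ_{b=1}^{R} Σ_{j ≤ J} [same]·Σᶠ_{Λ ∈ levelSetDep(j,b;μ) ∩ levelSetDep(j,b;μ_X) ∩ levelSetDep(j,b;μ_Y)} #Sol_{2b}(r_Λ)`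

Cell `hodgecm-mathlib` (D-0151), FLOOR 0, crux item H413 = `stmt-HodgeConjecture-24833`, route of record `HCCMUnconditional`; squad F0∕P3c∕LH4; lane
`--supports stmt-HodgeConjecture-24833 --as helper` (count-neutral; pays NO tier-0 row; the STAGE-1b rows `stub_rows_transvPlus ∕ transvMinus ∕ regular` stay OPEN).
THEOREMS ONLY (no `def`, no instance, no notation, no `sorry`).  Consumer: the STAGE-1b directive (heir LEAD F0P3a-plan, dealer LH4-plan), ROW (2) = TYPE-(2) POPULATION.

THE OBJECT.  The third residual unlabelled piece of ★ p858649 is the JOINT profile set `K_{a,b} = {u ∈ K ∣ X ∈ ϖ^a M₃(𝒪), X² ∈ ϖ^b M₃(𝒪)}` (`X = wMatrix u − 1`); its `G`-side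
census at `Γ` counts self-dual lattices with TWO tokens, `(Γ − 1)·M ⊆ ϖ^a·M ∧ (Γ − 1)²·M ⊆ ϖ^b·M`.  Part 1 (★ this seat, `…BlockGlueTwoTokenCount`) cut ★ p857501's glue count by
two generic block-at-1 tokens `X·M ⊆ c·M ∧ Y·M ⊆ c′·M`; this file translates the cut into the letters of the torus `T_γ ⊂ M = E(γ₂)` with TWO LINE MULTIPLIERS `ξ, η`
(`φ(X_W y) = ξ·φ y`, `φ(Y_W y) = η·φ y`):
* (part 2a, ★ `…OrderFormTwoTokensAxis`, imported) (W4₃) the W-side order census with THREE multipliers and (C₂^{X,Y}) the axis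
  `#{B ∣ SD_W, γ₂B = B, c⁻¹X_W·B ⊆ B, c′⁻¹Y_W·B ⊆ B} = Σ_{j<J+1} [IsOrd_j lam ∧ IsOrd_j ((jE c)⁻¹ξ) ∧ IsOrd_j ((jE c′)⁻¹η)]·#levelSet(j, 0)`.
* §1 the cut cone layer `b ≥ 1` in M-letters: `Σᶠ_{B₂ ∈ S_b^{X,c} ∩ T^{Y,c′}} #fibre = Σ_{j<J+1} [same]·Σᶠ_{Λ ∈ levelSetDep(j,b;lam − jE u) ∩ levelSetDep(j,b;(jE c)⁻¹(ξ − jE x₁₁)) ∩ levelSetDep(j,b;(jE c′)⁻¹(η − jE y₁₁))} f b j Λ`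
  (★ `tokenConeIndex_eq_inter`, ★ `finsum_coneWParts_eq_sum`, ★ `token_iff_lineToken` twice, ★ per-cell norm fibre) — the THREE-MULTIPLIER cells.
* §2 HEAD `ncard_fixed_selfDual_endoGL_twoToken_eq_orderForm` = ★ (C1) p857559 with a two-token indicator and three-multiplier cone cells.
For the piece `K_{a,b}` (`X = Γ − 1`, `Y = (Γ − 1)²`, `|c| ≤ 1`) the first cell factor is absorbed by the second (★ p858894 `depth_mul_of_depth`) and the cells are the TWO-multiplier
cells `levelSetDep(j,b;(jE c)⁻¹(lam − jE u₀₀)) ∩ levelSetDep(j,b;(jE c′)⁻¹((lam − 1)² − jE (u₀₀ − 1)²))` — LH4-p04 (g6)'s currency (★ p858876 ∕ p858944, `…ToricLevelCensusUnrTwoMult`); that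
instance is the sequel.
HONEST LABEL.  Count-neutral lattice bookkeeping over ★ organs; nothing printed is asserted; no census law is stated; `HC_CM` is proved only modulo the 7 printed citations (2 remaining
named inputs: hLiu418 = `stmt-HodgeConjecture-24832`, h413 = `stmt-HodgeConjecture-24833`) until rung 0 closes.

## References
* [Kottwitz1986BaseChangeUnits] R. E. Kottwitz, *Base change for unit elements of Hecke algebras*, Compositio Math. 60 (1986): §1 pp. 240–241.
* [BruhatTits1972] F. Bruhat, J. Tits, *Groupes réductifs sur un corps local I*, Publ. Math. IHÉS 41 (1972): §10.
* [Jacobowitz1962] R. Jacobowitz, *Hermitian forms over local fields*, Amer. J. Math. 84 (1962): §4, §7.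
* [Flicker1998UnitaryFL] Y. Z. Flicker, *Elementary proof of the fundamental lemma for a unitary group*, Canad. J. Math. 50 (1998): p. 84 REMARK.
-/

set_option autoImplicit false

noncomputable section

open scoped Valued WithZero Matrix MatrixGroups
open WithZero
open scoped Classical
open Literature.NumberTheory.Automorphic Literature.NumberTheory.Automorphic.HermitianLattice Literature.NumberTheory.Automorphic.UnitaryLatticeTree
open Literature.NumberTheory.Rogawski1990
open Literature.NumberTheory.Automorphic.EllipticPlaneAsFieldLine
open Literature.NumberTheory.LocalFields.QuadraticOrder
open Summit.HodgeConjecture.HodgeConjecture.Cruxes.H413.F0P3cDyRamToricCensusDefs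
open Summit.HodgeConjecture.HodgeConjecture.Cruxes.H413.F0P3cDyRamWSideOrderCensus
open Summit.HodgeConjecture.HodgeConjecture.Cruxes.H413.F0P3cDyRamConeLevelTransport
open Summit.HodgeConjecture.HodgeConjecture.Cruxes.H413.F0P3cDyRamBlockGlueCount
open Summit.HodgeConjecture.HodgeConjecture.Cruxes.H413.F0P3cDyRamBlockGluePlane
open Summit.HodgeConjecture.HodgeConjecture.Cruxes.H413.F0P3cDyRamBlockGlueLevelCount
open Summit.HodgeConjecture.HodgeConjecture.Cruxes.H413.F0P3cDyRamBlockGlueTokenCount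
open Summit.HodgeConjecture.HodgeConjecture.Cruxes.H413.F0P3cDyRamBlockGlueTwoTokenCount
open Summit.HodgeConjecture.HodgeConjecture.Cruxes.H413.F0P3cDyRamBlockCensusOrderForm
open Summit.HodgeConjecture.HodgeConjecture.Cruxes.H413.F0P3cDyRamBlockCensusOrderFormLevelAxis
open Summit.HodgeConjecture.HodgeConjecture.Cruxes.H413.F0P3cDyRamBlockCensusOrderFormLevel
open Summit.HodgeConjecture.HodgeConjecture.Cruxes.H413.F0P3cDyRamBlockCensusOrderFormToken
open Summit.HodgeConjecture.HodgeConjecture.Cruxes.H413.F0P3cDyRamBlockCensusOrderFormTwoTokensAxis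

namespace Summit.HodgeConjecture.HodgeConjecture.Cruxes.H413.F0P3cDyRamBlockCensusOrderFormTwoTokens

section Line

variable {E M : Type*} [Field E] [Valued E ℤᵐ⁰] [Field M] [Valued M ℤᵐ⁰] {ρ Θ : M →+* M} {α : M}

/-! ## §1 The cut cone layer with two tokens, in M-letters -/

/-- **THE CUT CONE LAYER `b ≥ 1` WITH TWO GENERIC TOKENS, IN M-LETTERS** (frame of ★ (C1) §2; `φ(X_W y) = ξ·φ y`, `φ(Y_W y) = η·φ y`; `c ≠ 0`, guard `|x₁₁| ≤ |c|` — the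
`Y`-token set `T^{Y,c′}` is already `w₀`-free, so no guard on `y₁₁` is needed here):
`Σᶠ_{B₂ ∈ S_b^{X,c} ∩ T^{Y,c′}} #fibre(ι_W B₂, b) = Σ_{j<J+1} [IsOrd_j lam ∧ IsOrd_j ((jE c)⁻¹ξ) ∧ IsOrd_j ((jE c′)⁻¹η)]·Σᶠ_{Λ ∈ levelSetDep(j,b;lam − jE u) ∩ levelSetDep(j,b;(jE c)⁻¹(ξ − jE x₁₁)) ∩ levelSetDep(j,b;(jE c′)⁻¹(η − jE y₁₁))} f b j Λ`
— the THREE-MULTIPLIER cells. [cite: Kottwitz1986BaseChangeUnits, §1 pp. 240–241] [cite: BruhatTits1972, §10] [cite: Jacobowitz1962, §4] -/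
theorem finsum_ncard_glueFibre_twoToken_eq_sum_levelSetDep_inter₃ [IsPrincipalIdealRing 𝒪[E]] (σ : E →+* E) (hσ : ∀ a, σ (σ a) = a)
    (hvσ : ∀ a, Valued.v (σ a) = Valued.v a) {ϖ : E} (hϖ : Valued.v ϖ = WithZero.exp (-1 : ℤ))
    {H₂ : Matrix (Fin 2) (Fin 2) E} (hH₂ : IsUnit H₂.det) (hH₂σ : (H₂.map σ)ᵀ = H₂) {hW : E} (hhW : Valued.v hW = 1) (hhWσ : σ hW = hW) (jE : E →+* M)
    (hρρ : ∀ x, ρ (ρ x) = x) (hvρ : ∀ x, Valued.v (ρ x) = Valued.v x) (hα : ρ α ≠ α) (hα1 : Valued.v α ≤ 1)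
    (hint : ∀ z : M, Valued.v z ≤ 1 → Valued.v ((z - ρ z) / (α - ρ α)) ≤ 1)
    (hΘΘ : ∀ x, Θ (Θ x) = x) (hΘρ : ∀ x, Θ (ρ x) = ρ (Θ x)) (hvΘ : ∀ x, Valued.v (Θ x) = Valued.v x) (hΘj : ∀ x, Θ (jE x) = jE (σ x))
    (hjv : ∀ c, Valued.v (jE c) ≤ 1 ↔ Valued.v c ≤ 1) (hjfix : ∀ z, ρ z = z ↔ ∃ c, jE c = z)
    (hjpow : ∀ (t : E) (n : ℤ), Valued.v (jE t) = Valued.v (jE ϖ) ^ n ↔ Valued.v t = Valued.v ϖ ^ n)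
    (hEval : ∀ c : M, ρ c = c → c ≠ 0 → Valued.v c ≤ 1 → ∃ n : ℕ, Valued.v c = Valued.v (jE ϖ) ^ n)
    (hϖmax : ∀ t : M, ρ t = t → Valued.v t < 1 → Valued.v t ≤ Valued.v (jE ϖ))
    (φ : (Fin 2 → E) →+ M) (hφs : ∀ (c : E) (x : Fin 2 → E), φ (c • x) = jE c * φ x) (hφi : Function.Injective φ) (hφo : Function.Surjective φ)
    {γ₂ : GL (Fin 2) E} {lam h : M} (hφγ : ∀ x, φ ((γ₂ : Matrix (Fin 2) (Fin 2) E).mulVec x) = lam * φ x) (hlam : Valued.v lam = 1)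
    (hΘh : Θ h = h) (hh : h ≠ 0) (hform : ∀ x y, jE (pairing σ H₂ x y) = h * Θ (φ x) * φ y + ρ (h * Θ (φ x) * φ y))
    (u : E) (hu : Valued.v u ≤ 1) {XW : Matrix (Fin 2) (Fin 2) E} {ξ : M} (hξ : ∀ y, φ (XW *ᵥ y) = ξ * φ y)
    {YW : Matrix (Fin 2) (Fin 2) E} {η : M} (hη : ∀ y, φ (YW *ᵥ y) = η * φ y) {x₁₁ y₁₁ c c' : E} (hc : c ≠ 0)
    (hxc : Valued.v x₁₁ ≤ Valued.v c)
    {b : ℕ} (hb : 1 ≤ b) {J : ℕ} (hJ : ¬ IsOrd ρ α (jE ϖ ^ (J + 1)) lam)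
    (hfin : ∀ j, j ≤ J → (levelSet ρ Θ α (jE ϖ) h j b).Finite)
    (f : ℕ → ℕ → AddSubgroup M → ℕ)
    (hf : ∀ (b j : ℕ) (Λ : AddSubgroup M) (x₀ : M) (r : E), 1 ≤ b → x₀ ≠ 0 →
      (∀ x, x ∈ Λ ↔ ∃ z, IsOrd ρ α (jE ϖ ^ j) z ∧ x = x₀ * z) →
      IsOrd ρ α (jE ϖ ^ j) (dualGen ρ Θ α (jE ϖ ^ j) h x₀) → ¬ IsOrd ρ α (jE ϖ ^ j) (dualGen ρ Θ α (jE ϖ ^ j) h x₀ / jE ϖ) →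
      Valued.v (dualGen ρ Θ α (jE ϖ ^ j) h x₀) = Valued.v (jE ϖ) ^ b →
      (∀ b', (∀ x ∈ Λ, Valued.v (h * Θ x * b' + ρ (h * Θ x * b')) ≤ 1) → (lam - jE u) * b' ∈ Λ) →
      IsOrd ρ α (jE ϖ ^ j) lam → jE r = glueUnit ρ Θ α (jE ϖ ^ j) h (jE ϖ) (jE hW) x₀ b →
      f b j Λ = Nat.card {x : 𝒪[E] ⧸ 𝓂[E] ^ (2 * b) // ∃ u' : 𝒪[E], Ideal.Quotient.mk (𝓂[E] ^ (2 * b)) u' = x ∧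
        Valued.v ((u' : E) * σ u' - r) ≤ Valued.v (ϖ ^ (2 * b))}) :
    ∑ᶠ B₂ ∈ {B : Submodule 𝒪[E] (Fin 2 → E) | (∃ g : GL (Fin 2) E, B = latt (g : Matrix (Fin 2) (Fin 2) E)) ∧ mapGL γ₂ B = B ∧
        (∀ y ∈ B, c⁻¹ • (XW *ᵥ y) ∈ B) ∧
        ∃ w₀ : Fin 2 → E, (∀ w, w ∈ B ↔ (w ∈ dualLatt σ H₂ B ∧ Valued.v (pairing σ H₂ w₀ w) ≤ 1)) ∧
          (∀ w ∈ dualLatt σ H₂ B, ∃ (t : E) (a : Fin 2 → E), Valued.v t ≤ 1 ∧ a ∈ B ∧ w = t • w₀ + a) ∧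
          Valued.v (pairing σ H₂ w₀ w₀) * Valued.v ϖ ^ (2 * b) = 1 ∧
          (γ₂ : Matrix (Fin 2) (Fin 2) E).mulVec w₀ - u • w₀ ∈ B ∧ c⁻¹ • (XW *ᵥ w₀ - x₁₁ • w₀) ∈ B} ∩
        {B : Submodule 𝒪[E] (Fin 2 → E) | (∀ y ∈ B, c'⁻¹ • (YW *ᵥ y) ∈ B) ∧ ∀ w ∈ dualLatt σ H₂ B, c'⁻¹ • (YW *ᵥ w - y₁₁ • w) ∈ B},
        {L : Submodule 𝒪[E] (Fin 3 → E) | IsSelfDualLattice σ ϖ (!![H₂ 0 0, 0, H₂ 0 1; 0, hW, 0; H₂ 1 0, 0, H₂ 1 1] : Matrix (Fin 3) (Fin 3) E) L ∧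
            L ⊓ LinearMap.ker ((LinearMap.proj (1 : Fin 3) : (Fin 3 → E) →ₗ[E] E).restrictScalars 𝒪[E]) =
              B₂.map ((Matrix.toLin' (!![1, 0; 0, 0; 0, 1] : Matrix (Fin 3) (Fin 2) E)).restrictScalars 𝒪[E]) ∧
            ∀ c : E, (Pi.single 1 c : Fin 3 → E) ∈ L ↔ Valued.v c ≤ Valued.v ϖ ^ b}.ncard =
      ∑ j ∈ Finset.range (J + 1), (if IsOrd ρ α (jE ϖ ^ j) lam ∧ IsOrd ρ α (jE ϖ ^ j) ((jE c)⁻¹ * ξ) ∧ IsOrd ρ α (jE ϖ ^ j) ((jE c')⁻¹ * η) then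
        ∑ᶠ Λ ∈ levelSetDep ρ Θ α (jE ϖ) h j b (lam - jE u) ∩ levelSetDep ρ Θ α (jE ϖ) h j b ((jE c)⁻¹ * (ξ - jE x₁₁)) ∩
          levelSetDep ρ Θ α (jE ϖ) h j b ((jE c')⁻¹ * (η - jE y₁₁)), f b j Λ else 0) := by
  have hvϖ0 : Valued.v ϖ ≠ 0 := by rw [hϖ]; exact WithZero.exp_ne_zero
  have hϖ0 : ϖ ≠ 0 := fun h0 => by rw [h0, map_zero] at hvϖ0; exact hvϖ0 rfl
  have hϖ1 : Valued.v ϖ < 1 := by rw [hϖ, ← WithZero.exp_zero, WithZero.exp_lt_exp]; norm_num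
  set TX : Set (Submodule 𝒪[E] (Fin 2 → E)) := {B | (∀ y ∈ B, c⁻¹ • (XW *ᵥ y) ∈ B) ∧
    ∀ w ∈ dualLatt σ H₂ B, c⁻¹ • (XW *ᵥ w - x₁₁ • w) ∈ B} with hTX
  set TY : Set (Submodule 𝒪[E] (Fin 2 → E)) := {B | (∀ y ∈ B, c'⁻¹ • (YW *ᵥ y) ∈ B) ∧
    ∀ w ∈ dualLatt σ H₂ B, c'⁻¹ • (YW *ᵥ w - y₁₁ • w) ∈ B} with hTY
  set fib : Submodule 𝒪[E] (Fin 2 → E) → ℕ := fun B₂ =>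
    {L : Submodule 𝒪[E] (Fin 3 → E) | IsSelfDualLattice σ ϖ (!![H₂ 0 0, 0, H₂ 0 1; 0, hW, 0; H₂ 1 0, 0, H₂ 1 1] : Matrix (Fin 3) (Fin 3) E) L ∧
        L ⊓ LinearMap.ker ((LinearMap.proj (1 : Fin 3) : (Fin 3 → E) →ₗ[E] E).restrictScalars 𝒪[E]) =
          B₂.map ((Matrix.toLin' (!![1, 0; 0, 0; 0, 1] : Matrix (Fin 3) (Fin 2) E)).restrictScalars 𝒪[E]) ∧
        ∀ c : E, (Pi.single 1 c : Fin 3 → E) ∈ L ↔ Valued.v c ≤ Valued.v ϖ ^ b}.ncard with hfib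
  rw [tokenConeIndex_eq_inter σ hσ hvσ ϖ hH₂σ γ₂ u XW hc hxc b, Set.inter_assoc]
  rw [show (∑ᶠ B₂ ∈ {B : Submodule 𝒪[E] (Fin 2 → E) | (∃ g : GL (Fin 2) E, B = latt (g : Matrix (Fin 2) (Fin 2) E)) ∧ mapGL γ₂ B = B ∧
        ∃ w₀ : Fin 2 → E, (∀ w, w ∈ B ↔ (w ∈ dualLatt σ H₂ B ∧ Valued.v (pairing σ H₂ w₀ w) ≤ 1)) ∧
          (∀ w ∈ dualLatt σ H₂ B, ∃ (t : E) (a : Fin 2 → E), Valued.v t ≤ 1 ∧ a ∈ B ∧ w = t • w₀ + a) ∧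
          Valued.v (pairing σ H₂ w₀ w₀) * Valued.v ϖ ^ (2 * b) = 1 ∧ (γ₂ : Matrix (Fin 2) (Fin 2) E).mulVec w₀ - u • w₀ ∈ B} ∩ (TX ∩ TY), fib B₂) =
      ∑ᶠ B₂ ∈ {B : Submodule 𝒪[E] (Fin 2 → E) | (∃ g : GL (Fin 2) E, B = latt (g : Matrix (Fin 2) (Fin 2) E)) ∧ mapGL γ₂ B = B ∧
        ∃ w₀ : Fin 2 → E, (∀ w, w ∈ B ↔ (w ∈ dualLatt σ H₂ B ∧ Valued.v (pairing σ H₂ w₀ w) ≤ 1)) ∧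
          (∀ w ∈ dualLatt σ H₂ B, ∃ (t : E) (a : Fin 2 → E), Valued.v t ≤ 1 ∧ a ∈ B ∧ w = t • w₀ + a) ∧
          Valued.v (pairing σ H₂ w₀ w₀) * Valued.v ϖ ^ (2 * b) = 1 ∧ (γ₂ : Matrix (Fin 2) (Fin 2) E).mulVec w₀ - u • w₀ ∈ B}, (TX ∩ TY).indicator fib B₂ by
    rw [finsum_mem_def, finsum_mem_def, Set.indicator_indicator]]
  rw [finsum_coneWParts_eq_sum σ hϖ0 hϖ1 H₂ jE hρρ hvρ hα hα1 hint hΘΘ hΘρ hvΘ hjv hjfix hjpow hEval hϖmax φ hφs hφi hφo hφγ hlam hΘh hh hform hu hb hJ hfin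
    ((TX ∩ TY).indicator fib)
    (fun j Λ => if (IsOrd ρ α (jE ϖ ^ j) ((jE c)⁻¹ * ξ) ∧
        (∀ b', (∀ x ∈ Λ, Valued.v (h * Θ x * b' + ρ (h * Θ x * b')) ≤ 1) → ((jE c)⁻¹ * (ξ - jE x₁₁)) * b' ∈ Λ)) ∧
        (IsOrd ρ α (jE ϖ ^ j) ((jE c')⁻¹ * η) ∧
        (∀ b', (∀ x ∈ Λ, Valued.v (h * Θ x * b' + ρ (h * Θ x * b')) ≤ 1) → ((jE c')⁻¹ * (η - jE y₁₁)) * b' ∈ Λ)) then f b j Λ else 0)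
    fun j B₂ hBdep hlamj => ?_]
  · refine Finset.sum_congr rfl fun j _ => ?_
    by_cases hlamj : IsOrd ρ α (jE ϖ ^ j) lam
    · rw [if_pos hlamj]
      by_cases hlam' : IsOrd ρ α (jE ϖ ^ j) ((jE c)⁻¹ * ξ) ∧ IsOrd ρ α (jE ϖ ^ j) ((jE c')⁻¹ * η)
      · rw [if_pos ⟨hlamj, hlam'⟩, finsum_mem_def, finsum_mem_def]
        refine finsum_congr fun Λ => ?_
        by_cases hΛ : Λ ∈ levelSetDep ρ Θ α (jE ϖ) h j b (lam - jE u)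
        · rw [Set.indicator_of_mem hΛ]
          have hΛ2 := hΛ
          obtain ⟨hlev, -⟩ := hΛ2
          by_cases hdep' : (∀ b', (∀ x ∈ Λ, Valued.v (h * Θ x * b' + ρ (h * Θ x * b')) ≤ 1) → ((jE c)⁻¹ * (ξ - jE x₁₁)) * b' ∈ Λ) ∧
              ∀ b', (∀ x ∈ Λ, Valued.v (h * Θ x * b' + ρ (h * Θ x * b')) ≤ 1) → ((jE c')⁻¹ * (η - jE y₁₁)) * b' ∈ Λ
          · have hΛ' : Λ ∈ levelSetDep ρ Θ α (jE ϖ) h j b (lam - jE u) ∩ levelSetDep ρ Θ α (jE ϖ) h j b ((jE c)⁻¹ * (ξ - jE x₁₁)) ∩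
                levelSetDep ρ Θ α (jE ϖ) h j b ((jE c')⁻¹ * (η - jE y₁₁)) :=
              ⟨⟨hΛ, hlev, hdep'.1⟩, hlev, hdep'.2⟩
            rw [Set.indicator_of_mem hΛ', if_pos ⟨⟨hlam'.1, hdep'.1⟩, hlam'.2, hdep'.2⟩]
          · have hΛ' : Λ ∉ levelSetDep ρ Θ α (jE ϖ) h j b (lam - jE u) ∩ levelSetDep ρ Θ α (jE ϖ) h j b ((jE c)⁻¹ * (ξ - jE x₁₁)) ∩
                levelSetDep ρ Θ α (jE ϖ) h j b ((jE c')⁻¹ * (η - jE y₁₁)) :=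
              fun h' => hdep' ⟨h'.1.2.2, h'.2.2⟩
            rw [Set.indicator_of_notMem hΛ', if_neg (fun h' => hdep' ⟨h'.1.2, h'.2.2⟩)]
        · have hΛ' : Λ ∉ levelSetDep ρ Θ α (jE ϖ) h j b (lam - jE u) ∩ levelSetDep ρ Θ α (jE ϖ) h j b ((jE c)⁻¹ * (ξ - jE x₁₁)) ∩
              levelSetDep ρ Θ α (jE ϖ) h j b ((jE c')⁻¹ * (η - jE y₁₁)) :=
            fun h' => hΛ h'.1.1
          rw [Set.indicator_of_notMem hΛ, Set.indicator_of_notMem hΛ']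
      · rw [if_neg (fun h' => hlam' h'.2), finsum_mem_def]
        refine finsum_eq_zero_of_forall_eq_zero fun Λ => ?_
        by_cases hΛ : Λ ∈ levelSetDep ρ Θ α (jE ϖ) h j b (lam - jE u)
        · rw [Set.indicator_of_mem hΛ, if_neg (fun h' => hlam' ⟨h'.1.1, h'.2.1⟩)]
        · rw [Set.indicator_of_notMem hΛ]
    · rw [if_neg hlamj, if_neg (fun h' => hlamj h'.1)]
  · obtain ⟨⟨x₀, hx₀, hΛx, hyO, hyprim, hylev⟩, hdepΛ⟩ := hBdep
    have htokX := token_iff_lineToken σ H₂ jE h hvρ hjv φ hφs hφi hφo hform hξ x₁₁ c hx₀ hΛx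
    have htokY := token_iff_lineToken σ H₂ jE h hvρ hjv φ hφs hφi hφo hform hη y₁₁ c' hx₀ hΛx
    by_cases hTB : B₂ ∈ TX ∩ TY
    · rw [Set.indicator_of_mem hTB, if_pos ⟨htokX.1 hTB.1, htokY.1 hTB.2⟩]
      obtain ⟨r, hr⟩ := exists_map_eq_glueUnit (ρ := ρ) (Θ := Θ) (α := α) jE hρρ hΘρ hjfix (jE ϖ ^ j) h x₀ ϖ hW b
      simp only [hfib]
      rw [ncard_glueFibre_eq_natCard_normFibre_of_gen σ hσ hvσ hϖ hH₂ hH₂σ hhW hhWσ jE hρρ hvρ hα hα1 hint hΘΘ hΘρ hvΘ hΘj hjv hjfix hjpow hϖmax φ hφs hφi hφo hφγ hlam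
          hΘh hh hform u hb hx₀ hΛx hyO hyprim hylev hdepΛ hlamj hr,
        hf b j _ x₀ r hb hx₀ hΛx hyO hyprim hylev hdepΛ hlamj hr]
    · rw [Set.indicator_of_notMem hTB, if_neg (fun h' => hTB ⟨htokX.2 h'.1, htokY.2 h'.2⟩)]

/-! ## §2 HEAD — the block census with two generic tokens, in M-letters -/

/-- **(C1-P^{X,Y}) THE BLOCK CENSUS WITH TWO GENERIC BLOCK TOKENS, IN M-LETTERS (HEAD).**  Frame of ★ (C1) (block form over `E`, `Γ = endoGL (γ₂, u)` UNITARY, line model, finite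
fixed family with tube coordinates `≤ R`, `lam ∉ 𝒪_{J+1}`, level sets finite, weights `f` = norm-residue counts on presented cells); `X`, `Y` block at `1` with compressions `X_W`,
`Y_W` and LINE MULTIPLIERS `ξ`, `η` (`φ(X_W y) = ξ·φ y`, `φ(Y_W y) = η·φ y`); `c, c′ ≠ 0`, guards `|X₁₁| ≤ |c|`, `|Y₁₁| ≤ |c′|`.  Then
`#{L ∣ SD, Γ·L = L, L.map X ≤ c·L, L.map Y ≤ c′·L} = Σ_{j<J+1} [IsOrd_j lam ∧ IsOrd_j ((jE c)⁻¹ξ) ∧ IsOrd_j ((jE c′)⁻¹η)]·#levelSet(j, 0)`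
`  + Σ_{b ∈ Icc 1 R} Σ_{j<J+1} [same]·Σᶠ_{Λ ∈ levelSetDep(j, b; lam − jE u₀₀) ∩ levelSetDep(j, b; (jE c)⁻¹(ξ − jE X₁₁)) ∩ levelSetDep(j, b; (jE c′)⁻¹(η − jE Y₁₁))} f b j Λ`
— ★ p859113 `ncard_fixed_selfDual_endoGL_twoToken_eq_axis_add_sum` ∘ ★ part 2a ∘ §1.  The piece `K_{a,b}`: `X = Γ − 1` (`ξ = lam − 1`, `X₁₁ = u₀₀ − 1`), `Y = (Γ − 1)²`
(`η = (lam − 1)²`, `Y₁₁ = (u₀₀ − 1)²`). [cite: Kottwitz1986BaseChangeUnits, §1 pp. 240–241] [cite: BruhatTits1972, §10] [cite: Jacobowitz1962, §4] [cite: Flicker1998UnitaryFL, p. 84 REMARK] -/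
theorem ncard_fixed_selfDual_endoGL_twoToken_eq_orderForm [IsPrincipalIdealRing 𝒪[E]] (σ : E →+* E) (hσ : ∀ a, σ (σ a) = a) (hvσ : ∀ a, Valued.v (σ a) = Valued.v a)
    {ϖ : E} (hϖ : Valued.v ϖ = WithZero.exp (-1 : ℤ))
    {H₂ : Matrix (Fin 2) (Fin 2) E} (hH₂ : IsUnit H₂.det) (hH₂σ : (H₂.map σ)ᵀ = H₂) {hW : E} (hhW : Valued.v hW = 1) (hhWσ : σ hW = hW) (jE : E →+* M)
    (hρρ : ∀ x, ρ (ρ x) = x) (hvρ : ∀ x, Valued.v (ρ x) = Valued.v x) (hα : ρ α ≠ α) (hα1 : Valued.v α ≤ 1)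
    (hint : ∀ z : M, Valued.v z ≤ 1 → Valued.v ((z - ρ z) / (α - ρ α)) ≤ 1)
    (hΘΘ : ∀ x, Θ (Θ x) = x) (hΘρ : ∀ x, Θ (ρ x) = ρ (Θ x)) (hvΘ : ∀ x, Valued.v (Θ x) = Valued.v x) (hΘj : ∀ x, Θ (jE x) = jE (σ x))
    (hjv : ∀ c, Valued.v (jE c) ≤ 1 ↔ Valued.v c ≤ 1) (hjfix : ∀ z, ρ z = z ↔ ∃ c, jE c = z)
    (hjpow : ∀ (t : E) (n : ℤ), Valued.v (jE t) = Valued.v (jE ϖ) ^ n ↔ Valued.v t = Valued.v ϖ ^ n)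
    (hEval : ∀ c : M, ρ c = c → c ≠ 0 → Valued.v c ≤ 1 → ∃ n : ℕ, Valued.v c = Valued.v (jE ϖ) ^ n)
    (hϖmax : ∀ t : M, ρ t = t → Valued.v t < 1 → Valued.v t ≤ Valued.v (jE ϖ))
    (φ : (Fin 2 → E) →+ M) (hφs : ∀ (c : E) (x : Fin 2 → E), φ (c • x) = jE c * φ x) (hφi : Function.Injective φ) (hφo : Function.Surjective φ)
    {γ₂ : GL (Fin 2) E} {lam h : M} (hφγ : ∀ x, φ ((γ₂ : Matrix (Fin 2) (Fin 2) E).mulVec x) = lam * φ x) (hlam : Valued.v lam = 1)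
    (hΘh : Θ h = h) (hh : h ≠ 0) (hform : ∀ x y, jE (pairing σ H₂ x y) = h * Θ (φ x) * φ y + ρ (h * Θ (φ x) * φ y))
    (u : GL (Fin 1) E) (hΓ : endoGL (γ₂, u) ∈ unitaryGroupOfForm σ (!![H₂ 0 0, 0, H₂ 0 1; 0, hW, 0; H₂ 1 0, 0, H₂ 1 1] : Matrix (Fin 3) (Fin 3) E))
    (hu : Valued.v ((u : Matrix (Fin 1) (Fin 1) E) 0 0) = 1)
    {X : Matrix (Fin 3) (Fin 3) E} (hcol : ∀ l, l ≠ 1 → X l 1 = 0) (hrow : ∀ l, l ≠ 1 → X 1 l = 0)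
    {ξ : M} (hξ : ∀ y, φ ((!![X 0 0, X 0 2; X 2 0, X 2 2] : Matrix (Fin 2) (Fin 2) E) *ᵥ y) = ξ * φ y)
    {Y : Matrix (Fin 3) (Fin 3) E} (hcolY : ∀ l, l ≠ 1 → Y l 1 = 0) (hrowY : ∀ l, l ≠ 1 → Y 1 l = 0)
    {η : M} (hη : ∀ y, φ ((!![Y 0 0, Y 0 2; Y 2 0, Y 2 2] : Matrix (Fin 2) (Fin 2) E) *ᵥ y) = η * φ y)
    {c c' : E} (hc : c ≠ 0) (hc' : c' ≠ 0) (hXc : Valued.v (X 1 1) ≤ Valued.v c) (hYc : Valued.v (Y 1 1) ≤ Valued.v c') {R : ℕ}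
    (hfinF : {L : Submodule 𝒪[E] (Fin 3 → E) |
      IsSelfDualLattice σ ϖ (!![H₂ 0 0, 0, H₂ 0 1; 0, hW, 0; H₂ 1 0, 0, H₂ 1 1] : Matrix (Fin 3) (Fin 3) E) L ∧ mapGL (endoGL (γ₂, u)) L = L}.Finite)
    (hR : ∀ L : Submodule 𝒪[E] (Fin 3 → E), IsSelfDualLattice σ ϖ (!![H₂ 0 0, 0, H₂ 0 1; 0, hW, 0; H₂ 1 0, 0, H₂ 1 1] : Matrix (Fin 3) (Fin 3) E) L →
      mapGL (endoGL (γ₂, u)) L = L → ∀ b : ℕ, (∀ c : E, (Pi.single 1 c : Fin 3 → E) ∈ L ↔ Valued.v c ≤ Valued.v ϖ ^ b) → b ≤ R)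
    {J : ℕ} (hJ : ¬ IsOrd ρ α (jE ϖ ^ (J + 1)) lam) (hfinLS : ∀ j a, (levelSet ρ Θ α (jE ϖ) h j a).Finite)
    (f : ℕ → ℕ → AddSubgroup M → ℕ)
    (hf : ∀ (b j : ℕ) (Λ : AddSubgroup M) (x₀ : M) (r : E), 1 ≤ b → x₀ ≠ 0 →
      (∀ x, x ∈ Λ ↔ ∃ z, IsOrd ρ α (jE ϖ ^ j) z ∧ x = x₀ * z) →
      IsOrd ρ α (jE ϖ ^ j) (dualGen ρ Θ α (jE ϖ ^ j) h x₀) → ¬ IsOrd ρ α (jE ϖ ^ j) (dualGen ρ Θ α (jE ϖ ^ j) h x₀ / jE ϖ) →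
      Valued.v (dualGen ρ Θ α (jE ϖ ^ j) h x₀) = Valued.v (jE ϖ) ^ b →
      (∀ b', (∀ x ∈ Λ, Valued.v (h * Θ x * b' + ρ (h * Θ x * b')) ≤ 1) → (lam - jE ((u : Matrix (Fin 1) (Fin 1) E) 0 0)) * b' ∈ Λ) →
      IsOrd ρ α (jE ϖ ^ j) lam → jE r = glueUnit ρ Θ α (jE ϖ ^ j) h (jE ϖ) (jE hW) x₀ b →
      f b j Λ = Nat.card {x : 𝒪[E] ⧸ 𝓂[E] ^ (2 * b) // ∃ u' : 𝒪[E], Ideal.Quotient.mk (𝓂[E] ^ (2 * b)) u' = x ∧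
        Valued.v ((u' : E) * σ u' - r) ≤ Valued.v (ϖ ^ (2 * b))}) :
    {L : Submodule 𝒪[E] (Fin 3 → E) |
        IsSelfDualLattice σ ϖ (!![H₂ 0 0, 0, H₂ 0 1; 0, hW, 0; H₂ 1 0, 0, H₂ 1 1] : Matrix (Fin 3) (Fin 3) E) L ∧ mapGL (endoGL (γ₂, u)) L = L ∧
          L.map ((Matrix.toLin' X).restrictScalars 𝒪[E]) ≤ scaleLattice c L ∧ L.map ((Matrix.toLin' Y).restrictScalars 𝒪[E]) ≤ scaleLattice c' L}.ncard =
      (∑ j ∈ Finset.range (J + 1), (if IsOrd ρ α (jE ϖ ^ j) lam ∧ IsOrd ρ α (jE ϖ ^ j) ((jE c)⁻¹ * ξ) ∧ IsOrd ρ α (jE ϖ ^ j) ((jE c')⁻¹ * η) then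
        (levelSet ρ Θ α (jE ϖ) h j 0).ncard else 0)) +
        ∑ b ∈ Finset.Icc 1 R, ∑ j ∈ Finset.range (J + 1),
          (if IsOrd ρ α (jE ϖ ^ j) lam ∧ IsOrd ρ α (jE ϖ ^ j) ((jE c)⁻¹ * ξ) ∧ IsOrd ρ α (jE ϖ ^ j) ((jE c')⁻¹ * η) then
            ∑ᶠ Λ ∈ levelSetDep ρ Θ α (jE ϖ) h j b (lam - jE ((u : Matrix (Fin 1) (Fin 1) E) 0 0)) ∩
              levelSetDep ρ Θ α (jE ϖ) h j b ((jE c)⁻¹ * (ξ - jE (X 1 1))) ∩ levelSetDep ρ Θ α (jE ϖ) h j b ((jE c')⁻¹ * (η - jE (Y 1 1))),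
              f b j Λ else 0) := by
  rw [ncard_fixed_selfDual_endoGL_twoToken_eq_axis_add_sum σ hσ hvσ hϖ hH₂ hH₂σ hhW γ₂ u hΓ hu hcol hrow hcolY hrowY hc hc' hXc hYc hfinF hR]
  congr 1
  · have hset : {B₂ : Submodule 𝒪[E] (Fin 2 → E) | IsSelfDualLattice σ ϖ H₂ B₂ ∧ mapGL γ₂ B₂ = B₂ ∧
          B₂.map ((Matrix.toLin' (!![X 0 0, X 0 2; X 2 0, X 2 2] : Matrix (Fin 2) (Fin 2) E)).restrictScalars 𝒪[E]) ≤ scaleLattice c B₂ ∧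
          B₂.map ((Matrix.toLin' (!![Y 0 0, Y 0 2; Y 2 0, Y 2 2] : Matrix (Fin 2) (Fin 2) E)).restrictScalars 𝒪[E]) ≤ scaleLattice c' B₂} =
        {B : Submodule 𝒪[E] (Fin 2 → E) | IsSelfDualLattice σ ϖ H₂ B ∧ mapGL γ₂ B = B ∧
          (∀ y ∈ B, c⁻¹ • ((!![X 0 0, X 0 2; X 2 0, X 2 2] : Matrix (Fin 2) (Fin 2) E) *ᵥ y) ∈ B) ∧
          ∀ y ∈ B, c'⁻¹ • ((!![Y 0 0, Y 0 2; Y 2 0, Y 2 2] : Matrix (Fin 2) (Fin 2) E) *ᵥ y) ∈ B} := by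
      ext B
      simp only [Set.mem_setOf_eq, map_toLin'_le_scaleLattice_iff_forall_mulVec_mem₂, mem_scaleLattice_iff hc, mem_scaleLattice_iff hc']
    rw [hset]
    exact ncard_selfDual_fixed_twoToken_plane_eq_sum_levelSet_zero σ hvσ hϖ hH₂ jE hρρ hvρ hα hα1 hint hΘΘ hΘρ hvΘ hjv hjfix hjpow hEval φ hφs hφi hφo hφγ hlam hh
      hform hJ (fun j => hfinLS j 0) hξ hη c c'
  · refine Finset.sum_congr rfl fun b hb => ?_
    exact finsum_ncard_glueFibre_twoToken_eq_sum_levelSetDep_inter₃ σ hσ hvσ hϖ hH₂ hH₂σ hhW hhWσ jE hρρ hvρ hα hα1 hint hΘΘ hΘρ hvΘ hΘj hjv hjfix hjpow hEval hϖmax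
      φ hφs hφi hφo hφγ hlam hΘh hh hform ((u : Matrix (Fin 1) (Fin 1) E) 0 0) hu.le hξ hη hc hXc (Finset.mem_Icc.1 hb).1 hJ (fun j _ => hfinLS j b) f hf

end Line

end Summit.HodgeConjecture.HodgeConjecture.Cruxes.H413.F0P3cDyRamBlockCensusOrderFormTwoTokens

end
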